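import Mathlib
import Summits.Ventures.FusionMHD.Models.RwmFRS1Kq07
import Literature.MathematicalPhysics.MHD.NewcombResonantAlgebraicCertificates
import HarnessLib

/-!
# F3 row «F3.σ-NEWCOMB-RES11-KQ07-UNSTABLE»: the RESONANT internal `(m, n) = (1, 1)` helicity of MODEL M_RWM,K (`Kq07.PK`) is Newcomb-UNSTABLE — decided WITHOUT SOLVING from two subsolutions regular across the singular ends (lit-4's `NewcombResonantAlgebraicCertificates` §4)

LADDER-GRIDFUSION rung F3 (cell `gridfusion`): statements + proofs by gridfusion-lit-4 g11 (template `HOME/lean/lit-4/templates/NewcombRes11Kq07.lean`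
17871fb364f3622c, OFFER C, INBOX 2026-08-28T01:34:59Z; lead g10 RULING 9ec (b) «book AT ACCEPT when a model seat files them»); FILED UNCHANGED but
for hygiene (imports `Mathlib`/`HarnessLib` first, this module docstring, a one-line docstring on every declaration that had none) by gridfusion-model-7 g7,
2026-08-28.  Every declaration, statement and proof below is lit-4's, byte-identical.  THREE COLUMNS (lit-4's sentence): CERTIFIED — there EXISTS an
admissible internal displacement (C¹ on (−51/50, 51/50) off r_s = √(3/7), ξ(1) = 0, finite energy (11.115)) with NEGATIVE reduced energy
`fluidEnergy 1 k 1 ξ < 0` for MODEL M_RWM,K, helicity (1,1) (Newcomb's Theorem 12, necessity, from the subsolutions w₁ ≡ 1 on (0, 1/2] and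
w₂ = 2r + 19 on [1/2, r_s) with the logarithmic-derivative mismatch 0 < 1/10; shear and Suydam at r_s PROVED; 0 kit); VALIDATED — none; MODELLED —
straight periodic cylinder, ideal MHD, single helicity, the exact force-balanced q₀ = 7/10 member; the energy-principle twin (δW < 0) of ★ #95's
σ-instability of the SAME model by a DIFFERENT mechanism — juxtaposed, not merged; nothing about a device. [instance data]
Citations: Freidberg 2014 §11.5.3 (11.110)–(11.118) [Freidberg2014]; Newcomb 1960 Thm 12 via lit-4's module; Hartman 2002 Ch. XI §3 [Hartman2002].

lit-4's template header, verbatim: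

> TEMPLATE (gridfusion lit-4 g11, 2026-08-28): «F3.σ-NEWCOMB-RES11-KQ07-UNSTABLE» — the RESONANT internal (m, n) = (1, 1) helicity of
> MODEL M_RWM,K (RwmFRS1.Kq07.PK = KinkEqQ07.hlK: B_z ≡ 1, B_θ = 2r/(7(1+r²)), p = 2/(49(1+r²)²) − 1/98 + 1/4900, μ₀ = 1, a = 1,
> k = −1/5; q = (7/10)(1+r²) = 1 at r_s = √(3/7) INSIDE the plasma) decided UNSTABLE WITHOUT SOLVING: Newcomb's Theorem 12
> (necessity) from two SUBSOLUTIONS regular across the singular ends, w₁ ≡ 1 on (0, 1/2] (g ≤ 0 there) and w₂ = 2r + 19 on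
> [1/2, r_s) (2f′ − g·(2r+19) = r²Q(r)/(1225(1+r²)³(r²+25)²), Q > 0), mismatch 0 < 1/10 — an admissible displacement with
> δW_F < 0 EXISTS (the energy-principle twin of ★ #95's σ-instability, by a different mechanism).  Compiles against the tree after
> p593450 (§4 of NewcombResonantAlgebraicCertificates).  Model seats: move into your namespace / Models file; nothing here is booked
> or filed by lit-4.
-/

noncomputable section

open Set Literature.MathematicalPhysics.MHD Literature.MathematicalPhysics.MHD.ScrewPinch

namespace Summit.Ventures.FusionMHD.Models

namespace RwmFRS1

namespace Kq07

namespace Res11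

/-! ### The (1,1) helicity of M_RWM,K: closed forms -/

/-- The resonant radius `r_s = √(3/7)` (`q(r_s) = 1`). [instance data] -/
def rs : ℝ := Real.sqrt (3 / 7)

/-- `rs_pos`: `: 0 < rs`. [instance data] -/
theorem rs_pos : 0 < rs := Real.sqrt_pos.2 (by norm_num)

/-- `rs_sq`: `: rs ^ 2 = 3 / 7`. [instance data] -/
theorem rs_sq : rs ^ 2 = 3 / 7 := Real.sq_sqrt (by norm_num)

/-- `rs_lt_one`: `: rs < 1`. [instance data] -/
theorem rs_lt_one : rs < 1 := by
  have h : rs ^ 2 < 1 ^ 2 := by rw [rs_sq]; norm_num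
  exact lt_of_pow_lt_pow_left₀ 2 (by norm_num) h

/-- `sq_lt_of_lt_rs`: `{r : ℝ} (hr : 0 < r) (h : r < rs) : r ^ 2 < 3 / 7`. [instance data] -/
theorem sq_lt_of_lt_rs {r : ℝ} (hr : 0 < r) (h : r < rs) : r ^ 2 < 3 / 7 := by
  rw [← rs_sq]; exact pow_lt_pow_left₀ h hr.le two_ne_zero

/-- The regular-axis factor `u = B_θ/r = 2/(7(1+r²))`. [instance data] -/
def u (r : ℝ) : ℝ := 2 / (7 * (1 + r ^ 2))

/-- `Bθ_eq_mul_u`: `(r : ℝ) : PK.Bθ r = r * u r`. [instance data] -/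
theorem Bθ_eq_mul_u (r : ℝ) : PK.Bθ r = r * u r := by
  rw [PK_Bθ, u]
  have h1 : (0 : ℝ) < 1 + r ^ 2 := by positivity
  field_simp

/-- `contDiff_u`: `: ContDiff ℝ 1 u`. [instance data] -/
theorem contDiff_u : ContDiff ℝ 1 u := by
  unfold u
  exact ContDiff.div contDiff_const (by fun_prop) fun x => by positivity

/-- `contDiff_Bθ_two`: `: ContDiff ℝ 2 PK.Bθ`. [instance data] -/
theorem contDiff_Bθ_two : ContDiff ℝ 2 PK.Bθ := by
  rw [show PK.Bθ = fun r : ℝ => 2 * r / (7 * (1 + r ^ 2)) from funext PK_Bθ]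
  exact ContDiff.div (by fun_prop) (by fun_prop) fun x => by positivity

/-- `contDiff_Bz_two`: `: ContDiff ℝ 2 PK.Bz`. [instance data] -/
theorem contDiff_Bz_two : ContDiff ℝ 2 PK.Bz := by
  rw [show PK.Bz = fun _ : ℝ => (1 : ℝ) from funext PK_Bz]
  exact contDiff_const

/-- `contDiff_p_two`: `: ContDiff ℝ 2 PK.p`. [instance data] -/
theorem contDiff_p_two : ContDiff ℝ 2 PK.p := by
  rw [show PK.p = fun r : ℝ => 2 / (49 * (1 + r ^ 2) ^ 2) - 1 / 98 + 1 / 4900 from funext PK_p]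
  refine ((ContDiff.div contDiff_const (by fun_prop) fun x => by positivity).sub contDiff_const).add contDiff_const

/-- `F = kB_z + mB_θ/r = (3 − 7r²)/(35(1+r²))` for `(m, k) = (1, −1/5)` (`r ≠ 0`). [cite: Freidberg2014, §11.5.1 eq. (11.90)] -/
theorem kDotB_eq {r : ℝ} (hr : r ≠ 0) : PK.kDotB 1 kk r = (3 - 7 * r ^ 2) / (35 * (1 + r ^ 2)) := by
  have h1 : (0 : ℝ) < 1 + r ^ 2 := by positivity
  rw [ScrewPinch.Profile.kDotB, PK_Bθ, PK_Bz, kk]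
  field_simp
  ring

/-- `F† = −(17 + 7r²)/(35(1+r²))` (`r ≠ 0`). [cite: Freidberg2014, §11.5.1 eq. (11.89)] -/
theorem kDotBDagger_eq {r : ℝ} (hr : r ≠ 0) : PK.kDotBDagger 1 kk r = -(17 + 7 * r ^ 2) / (35 * (1 + r ^ 2)) := by
  have h1 : (0 : ℝ) < 1 + r ^ 2 := by positivity
  rw [ScrewPinch.Profile.kDotBDagger, PK_Bθ, PK_Bz, kk]
  field_simp
  ring

/-- `k₀² = (r² + 25)/(25r²)` (`r ≠ 0`). [cite: Freidberg2014, §11.5.1 eq. (11.85)] -/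
theorem k0Sq_eq {r : ℝ} (hr : r ≠ 0) : ScrewPinch.Profile.k0Sq 1 kk r = (r ^ 2 + 25) / (25 * r ^ 2) := by
  rw [ScrewPinch.Profile.k0Sq, kk]
  field_simp
  ring

/-- `f = r³(3−7r²)²/(49(1+r²)²(r²+25))` (`r ≠ 0`). [cite: Freidberg2014, §11.5.1 eq. (11.90)] -/
theorem newcombF_eq {r : ℝ} (hr : r ≠ 0) :
    PK.newcombF 1 kk r = r ^ 3 * (3 - 7 * r ^ 2) ^ 2 / (49 * (1 + r ^ 2) ^ 2 * (r ^ 2 + 25)) := by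
  have h1 : (0 : ℝ) < 1 + r ^ 2 := by positivity
  have h2 : (0 : ℝ) < r ^ 2 + 25 := by positivity
  rw [ScrewPinch.Profile.newcombF, kDotB_eq hr, k0Sq_eq hr]
  field_simp
  ring

/-- The quartic `H(s) = (3−7s)²(1+s)(s+25) − 50(3−7s)(17+7s)(1+s) − 400(s+25)` of the numerator of `g` (WITH the pressure term).
[instance data] -/
def H (s : ℝ) : ℝ := -12325 + 1134 * s + 7492 * s ^ 2 + 3682 * s ^ 3 + 49 * s ^ 4

/-- `H_eq`: `(s : ℝ) : H s = (3 - 7 * s) ^ 2 * (1 + s) * (s + 25) - 50 * (3 - 7 * s) * (17 + 7 * s) * (1 + s) - 400 * (s + 25)`. [instance data] -/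
theorem H_eq (s : ℝ) : H s = (3 - 7 * s) ^ 2 * (1 + s) * (s + 25) - 50 * (3 - 7 * s) * (17 + 7 * s) * (1 + s) - 400 * (s + 25) := by
  unfold H; ring

/-- `g = r³H(r²)/(1225(1+r²)³(r²+25)²)` (`p′ = −8r/(49(1+r²)³)`, `r ≠ 0`). [cite: Freidberg2014, §11.5.1 eq. (11.90)] -/
theorem newcombG_eq {r : ℝ} (hr : r ≠ 0) :
    PK.newcombG 1 kk r = r ^ 3 * H (r ^ 2) / (1225 * (1 + r ^ 2) ^ 3 * (r ^ 2 + 25) ^ 2) := by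
  have h1 : (0 : ℝ) < 1 + r ^ 2 := by positivity
  have h2 : (0 : ℝ) < r ^ 2 + 25 := by positivity
  rw [ScrewPinch.Profile.newcombG, deriv_p, kDotB_eq hr, kDotBDagger_eq hr, k0Sq_eq hr, H, kk, PK_μ₀]
  field_simp
  ring

/-- `F(r_s) = 0`. [instance data] -/
theorem kDotB_rs : PK.kDotB 1 kk rs = 0 := by
  rw [kDotB_eq rs_pos.ne', rs_sq]; norm_num

/-- `F ≠ 0` on `(0, r_s)`. [instance data] -/
theorem kDotB_ne_zero_in {r : ℝ} (hr : r ∈ Ioo 0 rs) : PK.kDotB 1 kk r ≠ 0 := by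
  rw [kDotB_eq hr.1.ne']
  have h1 : (0 : ℝ) < 1 + r ^ 2 := by positivity
  have := sq_lt_of_lt_rs hr.1 hr.2
  exact div_ne_zero (by nlinarith) (by positivity)

/-- `F ≠ 0` at the axis: `kB_z(0) + m u(0) = 3/35`. [instance data] -/
theorem kDotB_axis : kk * PK.Bz 0 + 1 * u 0 ≠ 0 := by
  rw [PK_Bz, kk, u]; norm_num

/-- `F′` on `r > 0`: `F′ = −4r/(7(1+r²)²)`. [instance data] -/
theorem hasDerivAt_kDotB {r : ℝ} (hr : 0 < r) : HasDerivAt (PK.kDotB 1 kk) (-(4 * r) / (7 * (1 + r ^ 2) ^ 2)) r := by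
  have h1 : (0 : ℝ) < 1 + r ^ 2 := by positivity
  have hev : (fun s => (3 - 7 * s ^ 2) / (35 * (1 + s ^ 2))) =ᶠ[nhds r] PK.kDotB 1 kk := by
    filter_upwards [isOpen_Ioi.mem_nhds hr] with s hs
    rw [kDotB_eq (ne_of_gt hs)]
  have hd : HasDerivAt (fun s : ℝ => (3 - 7 * s ^ 2) / (35 * (1 + s ^ 2)))
      (((-(7 * (2 * r))) * (35 * (1 + r ^ 2)) - (3 - 7 * r ^ 2) * (35 * (2 * r))) / (35 * (1 + r ^ 2)) ^ 2) r := by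
    have hn : HasDerivAt (fun s : ℝ => 3 - 7 * s ^ 2) (-(7 * (2 * r))) r := by
      simpa using ((hasDerivAt_pow 2 r).const_mul 7).const_sub 3
    have hd' : HasDerivAt (fun s : ℝ => 35 * (1 + s ^ 2)) (35 * (2 * r)) r := by
      simpa using ((hasDerivAt_pow 2 r).const_add 1).const_mul 35
    exact hn.div hd' (by positivity)
  refine (hd.congr_of_eventuallyEq hev.symm).congr_deriv ?_
  field_simp
  ring

/-- `deriv_kDotB_rs`: `: deriv (PK.kDotB 1 kk) rs = -(4 * rs) / (7 * (1 + rs ^ 2) ^ 2)`. [instance data] -/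
theorem deriv_kDotB_rs : deriv (PK.kDotB 1 kk) rs = -(4 * rs) / (7 * (1 + rs ^ 2) ^ 2) := (hasDerivAt_kDotB rs_pos).deriv

/-- SHEAR at `r_s`: `F′(r_s) ≠ 0`. [instance data] -/
theorem shear_rs : deriv (PK.kDotB 1 kk) rs ≠ 0 := by
  rw [deriv_kDotB_rs]
  have h1 : (0 : ℝ) < 1 + rs ^ 2 := by positivity
  have := rs_pos
  exact div_ne_zero (by linarith) (by positivity)

/-- SUYDAM'S CRITERION at `r_s`: `r_sF′(r_s)² + 8μ₀k²p′(r_s) > 0` (`= (16 r_s/(49(1+r_s²)⁴))·((21/25) r_s² − 4/25)` with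
`r_s² = 3/7`). [instance data] -/
theorem suydam_rs : 0 < rs * deriv (PK.kDotB 1 kk) rs ^ 2 + 8 * PK.μ₀ * kk ^ 2 * deriv PK.p rs := by
  rw [deriv_kDotB_rs, deriv_p, PK_μ₀, kk]
  have h10 : 1 + rs ^ 2 = 10 / 7 := by rw [rs_sq]; norm_num
  rw [h10]
  have hr := rs_pos
  have e : rs * (-(4 * rs) / (7 * (10 / 7) ^ 2)) ^ 2 + 8 * 1 * (-1 / 5) ^ 2 * (-8 * rs / (49 * (10 / 7) ^ 3))
      = rs * (rs ^ 2 * (16 * 7 ^ 2 / 10 ^ 4) - 64 * 7 ^ 3 / (25 * 49 * 10 ^ 3)) := by ring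
  rw [e, rs_sq]
  have hc : (0 : ℝ) < 3 / 7 * (16 * 7 ^ 2 / 10 ^ 4) - 64 * 7 ^ 3 / (25 * 49 * 10 ^ 3) := by norm_num
  positivity

/-- `f′` in closed form. [instance data] -/
def fD (r : ℝ) : ℝ :=
  r ^ 2 * (3 - 7 * r ^ 2) * (225 - 1297 * r ^ 2 - 569 * r ^ 4 - 7 * r ^ 6) / (49 * (1 + r ^ 2) ^ 3 * (r ^ 2 + 25) ^ 2)

/-- `continuous_fD`: `: Continuous fD`. [instance data] -/
theorem continuous_fD : Continuous fD := by
  unfold fD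
  exact Continuous.div (by fun_prop) (by fun_prop) fun x => by positivity

/-- `f′ = fD` on `r > 0`. [instance data] -/
theorem hasDerivAt_newcombF {r : ℝ} (hr : 0 < r) : HasDerivAt (PK.newcombF 1 kk) (fD r) r := by
  have h1 : (0 : ℝ) < 1 + r ^ 2 := by positivity
  have h2 : (0 : ℝ) < r ^ 2 + 25 := by positivity
  have hev : (fun s => s ^ 3 * (3 - 7 * s ^ 2) ^ 2 / (49 * (1 + s ^ 2) ^ 2 * (s ^ 2 + 25))) =ᶠ[nhds r]
      PK.newcombF 1 kk := by
    filter_upwards [isOpen_Ioi.mem_nhds hr] with s hs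
    rw [newcombF_eq (ne_of_gt hs)]
  have hd : HasDerivAt (fun s : ℝ => s ^ 3 * (3 - 7 * s ^ 2) ^ 2 / (49 * (1 + s ^ 2) ^ 2 * (s ^ 2 + 25)))
      (((3 * r ^ 2 * (3 - 7 * r ^ 2) ^ 2 + r ^ 3 * (2 * (3 - 7 * r ^ 2) * (-(7 * (2 * r))))) *
          (49 * (1 + r ^ 2) ^ 2 * (r ^ 2 + 25)) -
        r ^ 3 * (3 - 7 * r ^ 2) ^ 2 * (49 * (2 * (1 + r ^ 2) * (2 * r)) * (r ^ 2 + 25) + 49 * (1 + r ^ 2) ^ 2 * (2 * r))) /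
        (49 * (1 + r ^ 2) ^ 2 * (r ^ 2 + 25)) ^ 2) r := by
    have hnum : HasDerivAt (fun s : ℝ => s ^ 3 * (3 - 7 * s ^ 2) ^ 2)
        (3 * r ^ 2 * (3 - 7 * r ^ 2) ^ 2 + r ^ 3 * (2 * (3 - 7 * r ^ 2) * (-(7 * (2 * r))))) r := by
      have ha := hasDerivAt_pow 3 r
      have hb : HasDerivAt (fun s : ℝ => 3 - 7 * s ^ 2) (-(7 * (2 * r))) r := by
        simpa using ((hasDerivAt_pow 2 r).const_mul 7).const_sub 3
      have hb2 := hb.pow 2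
      exact (ha.mul hb2).congr_deriv (by simp only [Pi.pow_apply]; push_cast; ring)
    have hden : HasDerivAt (fun s : ℝ => 49 * (1 + s ^ 2) ^ 2 * (s ^ 2 + 25))
        (49 * (2 * (1 + r ^ 2) * (2 * r)) * (r ^ 2 + 25) + 49 * (1 + r ^ 2) ^ 2 * (2 * r)) r := by
      have hc : HasDerivAt (fun s : ℝ => 1 + s ^ 2) (2 * r) r := by
        simpa using (hasDerivAt_pow 2 r).const_add 1
      have hc2 := (hc.pow 2).const_mul 49
      have he : HasDerivAt (fun s : ℝ => s ^ 2 + 25) (2 * r) r := by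
        simpa using (hasDerivAt_pow 2 r).add_const 25
      exact (hc2.mul he).congr_deriv (by simp only [Pi.pow_apply]; push_cast; ring)
    exact hnum.div hden (by positivity)
  refine (hd.congr_of_eventuallyEq hev.symm).congr_deriv ?_
  unfold fD
  field_simp
  ring

/-- `|fD| ≤ r` on `(0, 1]`. [instance data] -/
theorem abs_fD_le {r : ℝ} (hr : 0 < r) (hr1 : r ≤ 1) : |fD r| ≤ r := by
  have h1 : (0 : ℝ) < 1 + r ^ 2 := by positivity
  have h2 : (0 : ℝ) < r ^ 2 + 25 := by positivity
  have hden : 0 < 49 * (1 + r ^ 2) ^ 3 * (r ^ 2 + 25) ^ 2 := by positivity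
  unfold fD
  rw [abs_div, abs_of_pos hden, div_le_iff₀ hden]
  have hr2 : r ^ 2 ≤ 1 := by nlinarith
  have hA : |3 - 7 * r ^ 2| ≤ 4 := by rw [abs_le]; constructor <;> nlinarith
  have hB : |225 - 1297 * r ^ 2 - 569 * r ^ 4 - 7 * r ^ 6| ≤ 2098 := by
    have h4 : r ^ 4 ≤ 1 := by nlinarith
    have h6 : r ^ 6 ≤ 1 := by nlinarith
    rw [abs_le]; constructor <;> nlinarith
  have hnum : |r ^ 2 * (3 - 7 * r ^ 2) * (225 - 1297 * r ^ 2 - 569 * r ^ 4 - 7 * r ^ 6)| ≤ r ^ 2 * 4 * 2098 := by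
    rw [abs_mul, abs_mul, abs_of_nonneg (sq_nonneg r)]
    have := mul_le_mul hA hB (abs_nonneg _) (by norm_num)
    nlinarith [sq_nonneg r]
  have hlow : 49 * 1 ^ 3 * 25 ^ 2 ≤ 49 * (1 + r ^ 2) ^ 3 * (r ^ 2 + 25) ^ 2 := by
    gcongr <;> nlinarith [sq_nonneg r]
  nlinarith [sq_nonneg r]

/-! ### The two subsolutions -/

/-- `H < 0` on `[0, 1/2]`. [instance data] -/
theorem H_neg {s : ℝ} (h0 : 0 ≤ s) (h1 : s ≤ 1 / 2) : H s < 0 := by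
  unfold H
  have h2 : s ^ 2 ≤ 1 / 4 := by nlinarith
  have h3 : s ^ 3 ≤ 1 / 8 := by nlinarith
  have h4 : s ^ 4 ≤ 1 / 16 := by nlinarith
  nlinarith

/-- `w₁ ≡ 1` is a SUBSOLUTION on `(0, 1/2)`: `g · 1 ≤ 0 = (f · 0)′`. [instance data] -/
theorem sub₁ {r : ℝ} (hr : r ∈ Ioo (0 : ℝ) (1 / 2)) : PK.newcombG 1 kk r * 1 ≤ 0 := by
  rw [mul_one, newcombG_eq hr.1.ne']
  have hs : r ^ 2 ≤ 1 / 2 := by nlinarith [hr.1, hr.2]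
  have hH := H_neg (sq_nonneg r) hs
  have hr3 : 0 < r ^ 3 := by have := hr.1; positivity
  apply div_nonpos_of_nonpos_of_nonneg _ (by positivity)
  nlinarith

/-- THE SUBSOLUTION IDENTITY for `w₂ = 2r + 19`: `2f′ − g·(2r+19) = r²Q(r)/(1225(1+r²)³(r²+25)²)`. [instance data] -/
theorem sub_identity {r : ℝ} (hr : r ≠ 0) :
    fD r * 2 - PK.newcombG 1 kk r * (2 * r + 19)
      = r ^ 2 * (33750 + 234175 * r - 248650 * r ^ 2 - 21546 * r ^ 3 + 366332 * r ^ 4 - 142348 * r ^ 5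
          + 183116 * r ^ 6 - 69958 * r ^ 7 - 4914 * r ^ 8 - 931 * r ^ 9 - 98 * r ^ 10)
          / (1225 * (1 + r ^ 2) ^ 3 * (r ^ 2 + 25) ^ 2) := by
  have h1 : (0 : ℝ) < 1 + r ^ 2 := by positivity
  have h2 : (0 : ℝ) < r ^ 2 + 25 := by positivity
  rw [newcombG_eq hr, fD, H]
  field_simp
  ring

/-- `Q > 0` on `[1/2, 66/100]` (crude monomial bounds). [instance data] -/
theorem Q_pos {r : ℝ} (h0 : 1 / 2 ≤ r) (h1 : r ≤ 66 / 100) :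
    0 < 33750 + 234175 * r - 248650 * r ^ 2 - 21546 * r ^ 3 + 366332 * r ^ 4 - 142348 * r ^ 5
          + 183116 * r ^ 6 - 69958 * r ^ 7 - 4914 * r ^ 8 - 931 * r ^ 9 - 98 * r ^ 10 := by
  have hr0 : 0 ≤ r := by linarith
  have u2 : r ^ 2 ≤ (66 / 100) ^ 2 := pow_le_pow_left₀ hr0 h1 2
  have u3 : r ^ 3 ≤ (66 / 100) ^ 3 := pow_le_pow_left₀ hr0 h1 3
  have u5 : r ^ 5 ≤ (66 / 100) ^ 5 := pow_le_pow_left₀ hr0 h1 5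
  have u7 : r ^ 7 ≤ (66 / 100) ^ 7 := pow_le_pow_left₀ hr0 h1 7
  have u8 : r ^ 8 ≤ (66 / 100) ^ 8 := pow_le_pow_left₀ hr0 h1 8
  have u9 : r ^ 9 ≤ (66 / 100) ^ 9 := pow_le_pow_left₀ hr0 h1 9
  have u10 : r ^ 10 ≤ (66 / 100) ^ 10 := pow_le_pow_left₀ hr0 h1 10
  have l4 : (1 / 2 : ℝ) ^ 4 ≤ r ^ 4 := pow_le_pow_left₀ (by norm_num) h0 4
  have l6 : (1 / 2 : ℝ) ^ 6 ≤ r ^ 6 := pow_le_pow_left₀ (by norm_num) h0 6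
  nlinarith

/-- `w₂ = 2r + 19` is a SUBSOLUTION on `(1/2, r_s)`: `g·(2r+19) ≤ (f·2)′ = 2f′`. [instance data] -/
theorem sub₂ {r : ℝ} (hr : r ∈ Ioo (1 / 2 : ℝ) rs) : PK.newcombG 1 kk r * (2 * r + 19) ≤ fD r * 2 := by
  have hr0 : 0 < r := by linarith [hr.1]
  have h := sub_identity hr0.ne'
  have hs := sq_lt_of_lt_rs hr0 hr.2
  have hr66 : r ≤ 66 / 100 := by nlinarith
  have hQ := Q_pos hr.1.le hr66
  have h1 : (0 : ℝ) < 1 + r ^ 2 := by positivity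
  have h2 : (0 : ℝ) < r ^ 2 + 25 := by positivity
  have hpos : 0 ≤ r ^ 2 * (33750 + 234175 * r - 248650 * r ^ 2 - 21546 * r ^ 3 + 366332 * r ^ 4 - 142348 * r ^ 5
          + 183116 * r ^ 6 - 69958 * r ^ 7 - 4914 * r ^ 8 - 931 * r ^ 9 - 98 * r ^ 10)
          / (1225 * (1 + r ^ 2) ^ 3 * (r ^ 2 + 25) ^ 2) := by
    apply div_nonneg _ (by positivity)
    positivity
  linarith

/-! ### The verdict -/

/-- **THE INTERNAL `(1,1)` MODE OF MODEL M_RWM,K IS UNSTABLE IN THE ENERGY PRINCIPLE** (`q = 1` at `r_s = √(3/7)` inside the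
plasma): THERE EXISTS an admissible displacement (`C¹` on `(−51/50, 51/50)` off `r_s`, `ξ(1) = 0`, finite energy (11.115)) with
NEGATIVE reduced energy `fluidEnergy 1 k 1 ξ < 0` — Newcomb's Theorem 12 necessity decided WITHOUT SOLVING by the subsolutions
`w₁ ≡ 1` on `(0, 1/2]` and `w₂ = 2r + 19` on `[1/2, r_s)` with `w₁′/w₁(1/2) = 0 < 1/10 = w₂′/w₂(1/2)`.  MODELLED: straight cylinder,
ideal MHD, the exact force-balanced `q₀ = 7/10` equilibrium; nothing about a device. [instance data] -/
theorem internal_unstable_11 :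
    ∃ ξ : ℝ → ℝ, ContDiffOn ℝ 1 ξ (Ioo (-(51 / 50)) (51 / 50) \ {rs}) ∧ ξ 1 = 0 ∧ PK.FiniteEnergyOn 1 kk 0 1 ξ ∧
      PK.fluidEnergy 1 kk 1 ξ < 0 := by
  have hr₀ : (0 : ℝ) < 1 / 2 := by norm_num
  have hr₀ₛ : (1 / 2 : ℝ) < rs := by
    have h : (1 / 2 : ℝ) ^ 2 < rs ^ 2 := by rw [rs_sq]; norm_num
    exact lt_of_pow_lt_pow_left₀ 2 rs_pos.le h
  have hODE₁ : ∀ r ∈ Ioo (0 : ℝ) (1 / 2),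
      HasDerivAt (fun x => PK.newcombF 1 kk x * deriv (fun _ : ℝ => (1 : ℝ)) x) ((fun _ : ℝ => (0 : ℝ)) r) r := by
    intro r _
    have e : (fun x => PK.newcombF 1 kk x * deriv (fun _ : ℝ => (1 : ℝ)) x) = fun _ => 0 := by funext x; simp
    rw [e]; exact hasDerivAt_const r 0
  have hd2 : ∀ x : ℝ, deriv (fun y : ℝ => 2 * y + 19) x = 2 := by
    intro x
    have : HasDerivAt (fun y : ℝ => 2 * y + 19) (2 * 1) x := ((hasDerivAt_id x).const_mul 2).add_const 19
    rw [this.deriv]; norm_num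
  have hODE₂ : ∀ r ∈ Ioo (1 / 2 : ℝ) rs,
      HasDerivAt (fun x => PK.newcombF 1 kk x * deriv (fun y : ℝ => 2 * y + 19) x) (fD r * 2) r := by
    intro r hr
    have e : (fun x => PK.newcombF 1 kk x * deriv (fun y : ℝ => 2 * y + 19) x) = fun x => PK.newcombF 1 kk x * 2 := by
      funext x; rw [hd2]
    rw [e]
    exact (hasDerivAt_newcombF (hr₀.trans hr.1)).mul_const 2
  have hmis : deriv (fun _ : ℝ => (1 : ℝ)) (1 / 2) / (fun _ : ℝ => (1 : ℝ)) (1 / 2)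
      < deriv (fun y : ℝ => 2 * y + 19) (1 / 2) / (fun y : ℝ => 2 * y + 19) (1 / 2) := by
    rw [hd2]; simp only [deriv_const']; norm_num
  exact Profile.exists_fluidEnergy_neg_oneResonance_of_innerSubsolutions (P := PK) (m := 1) (k := kk) (a := 1)
    (b := 51 / 50) (M := 1) (w₁ := fun _ => 1) (w₂ := fun y => 2 * y + 19) (q₁ := fun _ => 0) (q₂ := fun r => fD r * 2)
    (Q₁ := 0) (Q₂ := 1) hr₀ hr₀ₛ rs_lt_one (by norm_num) one_ne_zero (by norm_num)
    contDiff_Bθ_two.contDiffOn contDiff_Bz_two.contDiffOn contDiff_p_two.contDiffOn contDiff_u.contDiffOn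
    (fun r _ => Bθ_eq_mul_u r) kDotB_rs (fun r hr => kDotB_ne_zero_in hr) kDotB_axis shear_rs suydam_rs
    contDiffOn_const (fun _ _ => one_pos) continuousOn_const (fun _ _ => by simp) hODE₁ (fun r hr => sub₁ hr)
    (by fun_prop) (fun r hr => by linarith [hr.1])
    ((continuous_fD.mul continuous_const).continuousOn)
    (fun r hr => by
      have hr0 : 0 < r := hr₀.trans_le hr.1
      have hb := abs_fD_le hr0 (by linarith [hr.2, rs_lt_one])
      rw [abs_mul, abs_two]
      nlinarith [abs_nonneg (fD r)])
    hODE₂ (fun r hr => sub₂ hr) hmis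

end Res11

end Kq07

end RwmFRS1

end Summit.Ventures.FusionMHD.Models

end
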